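import Summits.HodgeConjecture.HodgeConjecture.Theorems.F0P6aPELInputs
import Summits.HodgeConjecture.HodgeConjecture.Theorems.F0P6aEReadings
import Summits.HodgeConjecture.HodgeConjecture.Theorems.F0P6aChartFramePin
import Literature.AlgebraicGeometry.ModuliOfAbelianVarieties.SiegelFineModuliSlicePointSeparation
import Literature.AlgebraicGeometry.ShimuraVarieties.UnitaryCurveAuxiliaryIntegralActionFamilyV
import Literature.AlgebraicGeometry.ShimuraVarieties.SaturatedSmallLevelFamily
import Literature.AlgebraicGeometry.ModuliOfAbelianVarieties.SiegelUniversalFamilyUniformisationHolds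
import Summits.HodgeConjecture.HodgeConjecture.Theorems.F0P6aStubEHECKE
import Summits.HodgeConjecture.HodgeConjecture.Theorems.F0P6aStubESHEET
import HarnessLib
import HarnessLib.Audit.LibrarySuggestionsDenyListCruxes

/-!
# `F0P6aEExports` — ★ VERBATIM TWIN (K6 P∕E column wave E3, LEAD F0P6-plan «M-142a» (B); RE-HOME TABLE v1.7 (LA7-plan (g7)), canonical header «M-142a» (A), carrier «M-142d» «P-κ») of the X-leaf `Lines/F0_P6a_EExports.lean`

**SIZE-LINT SPLIT ×3** (`Theorems/` files with proofs are ≤ 400 lines): parts `Theorems/F0P6aEExportsReadings.lean` → `Theorems/F0P6aEExportsFrames.lean` → `Theorems/F0P6aEExports.lean`, each importing the previous, cut at declaration boundaries of `Lines/F0_P6a_EExports.lean`; namespaces AND sections KEPT and re-opened per part (with their `open`∕`variable` lines replayed verbatim); the options preamble is repeated. This is PART 1.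

This `Theorems/` module is the TREE BYTES of `Summits/HodgeConjecture/HodgeConjecture/Cruxes/HLiu418/Lines/F0_P6a_EExports.lean` (tree sha16 799e66f2cd7835ce, 701 l.; sorry-free, stub-free = class B of RE-HOME TABLE v1.7)
re-homed VERBATIM with the NAMESPACE KEPT (`Summit.HodgeConjecture.HodgeConjecture.Cruxes.HLiu418.F0P6aEExports`), so every fully-qualified name of its 14 declarations is UNCHANGED
(0 FQN moves, 0 downstream bytes, 0 statement bytes).  The only edits are (a) this re-headed module docstring, (b) the `Lines` imports switched to their ★ homes (l.1 `Lines.F0_P6a_PELInputs` → `Theorems.F0P6aPELInputs`; l.2 `Lines.F0_P6a_EReadings` → `Theorems.F0P6aEReadings`; l.3 `Lines.F0_P6a_ChartFramePin` → `Theorems.F0P6aChartFramePin`; l.7 `Lines.F0_P6a_StubEHECKE` → `Theorems.F0P6aStubEHECKE`; l.8 `Lines.F0_P6a_StubESHEET` → `Theorems.F0P6aStubESHEET`),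
and (c) on the docstrings of the header-CLOSED `def … : Prop` letters (`RecordEHeckeReading`, `RecordESheetReading`, `RecordEFrames`) the locator tokens are spelled `(print: …)` instead of `[cite: …]` — same locators, same prose — because a `[cite:]`-tagged closed Prop in a `Theorems/` proposal is
RELOCATED to `Literature/` by the gate («STATE IT INLINE» rule; observed p852785∕p852786, LA-ref1 (g5) BOX K5 #R1), which would MOVE the FQN; these Props are statement
ABBREVIATIONS of our own sockets, not printed facts (precedent ★ `Theorems/F0P6aModuliDatumDefs.lean` `RecordModuliDatumCofinal` `(print:)` ×5).

Why: E-column parents-first — this X-leaf imports the P-LINE (★ K5 №5), the E-READINGS (★ E1), the frame pin (★ since K3) and the two closer leaves EHECKE ∕ ESHEET (★ E2b ∕ E2c),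
and is imported by `F0_P6a_StubGEN` → `F0_P6a_PELSpread` hub → MAIN; a `Theorems/` file cannot import a `Lines/` workfile (gate import fence).  Its three PAID letters
`stub_EHECKE` ∕ `stub_ESHEET` ∕ `stub_EFRAMES` are BY-TERM (types = this module՚s closed `Record…` defs, NOT the ★ heads՚ statements token for token) and twin verbatim;
should the gate read them as `dedup.landed` anyway, «M-142h» (iv) applies (they stay hub-side).  After its LAST part is ★ the `Lines` original becomes the next edition = SHIM.
HC_CM is proved only modulo the 7 printed citations (2 remaining: hLiu418 = stmt-HodgeConjecture-24832, h413 = stmt-HodgeConjecture-24833) until rung 0 closes; a re-home is count-neutral.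

## Import provenance (header is CANONICAL: bare `import` lines, «M-142a» (A); the ROOT part carries `HarnessLib.Audit.LibrarySuggestionsDenyListCruxes`, «M-142d» «P-κ»)
v2 (custodian LA2-plan (g5), LEAD «M-146» (6)): the two code uses of the `Lines`-only by-name alias `stub_UNIVFAM` (E-LINE `EExports` :262–:263) are RESPELLED by the ★ term `Literature.AlgebraicGeometry.ModuliOfAbelianVarieties.siegelUniversalFamilyUniformisation_holds` (★ p849986; type-identical, statement-neutral — (d1)(ii) class), and its module is imported bare; no other byte differs from v1 f67373410f6e8c8c.
- `Summits.HodgeConjecture.HodgeConjecture.Theorems.F0P6aPELInputs` — ★ K5 №5 p852908: the P-LINE twin (`Lines` module = ED. 5 shim)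
- `Summits.HodgeConjecture.HodgeConjecture.Theorems.F0P6aEReadings` — ★ K6 E1 twin (LAST part)
- `Summits.HodgeConjecture.HodgeConjecture.Theorems.F0P6aChartFramePin` — ★ p850217 (`Lines` module = ED. 2 shim since K3)
- `Literature.AlgebraicGeometry.ModuliOfAbelianVarieties.SiegelFineModuliSlicePointSeparation` — ★ p849317 (LA4-p01 (g2)) `SiegelFineModuliScheme.eq_of_tupleRel_id_thickeningLift`: (S-E) for every ED.-5 witness
- `Literature.AlgebraicGeometry.ShimuraVarieties.UnitaryCurveAuxiliaryIntegralActionFamilyV` — ★ p849552 (LA5-p01 (g3)) 7b-FAMILY `exists_symplecticFrameV_family_integralAction` (COMMON LATTICE) — `stub_EFRAMES` payment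
- `Literature.AlgebraicGeometry.ShimuraVarieties.SaturatedSmallLevelFamily` — ★ p849614 (LA4-p02 (g2)) `exists_smallLevel_saturated_family_of_prod_le` (COMMON SMALL LEVEL, normal in `K`) — `stub_EFRAMES` payment
- `Summits.HodgeConjecture.HodgeConjecture.Theorems.F0P6aStubEHECKE` — ★ K6 E2b twin of the EHECKE closer leaf (LAST of 6 parts)
- `Summits.HodgeConjecture.HodgeConjecture.Theorems.F0P6aStubESHEET` — ★ K6 E2c twin of the ESHEET closer leaf (LAST of 3 parts)
- `HarnessLib`

## Original module docstring (verbatim)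
# `F0_P6a_EExports` — THE E-EXPORTS LEAF «X» ABOVE THE E-LINE: (S-E) `ESepAt`, (H-E) `EHeckeAt`, (T-E) `ETwistKerAt` FOR A WITNESS REBUILT WITH ITS READING

**EDITION 2 (cand v1, prep LA5-p01 (g4) for the E-pen A-p01 (g28), LEAD «M-86» PLATE 1):** the two reading sockets are PAID BY NAME from the closer leaves —
`stub_EHECKE := F0P6aStubEHECKE.stub_EHECKE_of_line` and `stub_ESHEET := F0P6aStubESHEET.stub_ESHEET_of_line` (two imports added; statement texts byte-identical;
in-file sorries 2 → 0; the open organ sockets now live in the closers: `F0P6aStubEHECKE.stub_ER1`, `F0P6aStubESHEET.stub_SHEET`).  Every other byte = ED. 1 184468800dd36650.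
(E-pen A-p01 (g28), 2026-09-02; LA4-plan (g0) DEAL #18 ∕ LA4-p01 (g2) census 05:00:18Z «(H-E)∕(T-E): HOLDER NONE → E-pen»; proposal «X-LEAF» 05:06:58Z, LEAD heir F0P6-plan (g3) to rule)

CRUX `stmt-HodgeConjecture-24832` (HLiu418), sub-line P6a.  CONSUMER: GEN՚s closer leaf `Lines/F0_P6a_StubGEN.lean` (A-p18 (g32) cand d41c4085), socket
`stub_GEN : RecordGENChoicesCofinal`, whose E-block for the chosen witness `Ef i` reads, per good split place `w`,
`ESepAt S Kc w (Ef i) ∧ (∀ p f, Nat.Prime p → (p : 𝓞 F) ∈ 𝔭_w → Nat.card (𝓞 F ⧸ 𝔭_{c•w}) = p ^ f → EHeckeAt S hU7ₛ hJ hJu Kc w hw (Ef i) p f ∧ ∀ e, ETwistKerAt S Kc w e (Ef i) p f)`.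

WHY THIS LEAF (numbers).  The E-LINE ED. 5 head `pelWitnessE_of_line` delivers `Nonempty (PELWitnessE …)`; the two moduli readings (H-E) (66-line `HeckeRoofsE`) and (T-E)
(49-line `ETwistKerAt`, rows (K-law)∕(cover) = the SHEET LAW) are properties of the witness that need, in their proofs, (i) the admissible-MARKING READING of the
`𝒪_F`-action at complex points — the L6 leaf՚s `F0P6aStubE6.RingActionReading C ε ρ` — (ii) the chart `C : AuxChartGS …` (`f_pts`, `q_spec`, `Mρ_frame`, `cm_recip`,
`junction`) TOGETHER WITH THE E1 FRAME `Fr` it was cut from (the torus leg `ũ_V(1,t)` carrying the central twist of the sheet law, the `w`-adic lattices of `F²`;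
`Lines/F0_P6a_ChartFramePin.lean` `IsChartOfFrame`) and (iii) the slice `ε` with its inducing law; `PELWitnessE` carries none of (i)(ii).  Instead of widening `PELWitnessE` (E-line ED. 6 + Defs ED. 6 +
a 7-module cone rebuild), this leaf REBUILDS the witness: the chart of a GIVEN frame at every deep saturated level (`chart_of_frame` = the E-line՚s PAID `stub_E123` body by
copy with the frame as INPUT and the frame pin as OUTPUT, §6a, LA4-p02 (g2)), all frames of a finite family on ONE lattice at ONE common small level (★ p849552 7b-FAMILY,
★ p849614; `eFrames_of_line` pays the letter `RecordEFrames`, §6), then `stub_E4` (`ψ` over `ℂ`), `stub_E5` (`ε` over `Fᵢ`), ★ `algPoints_map_injective_of_sliceDescent` (`sep`),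
and the L6 leaf՚s SORRY-FREE reading chain Σ-AN ★ `readsCReading_of_junction` → Σ-GAL `sigmaGAL_of_stub` → `readsC_of_galois_of_reading` → `exists_reads_of_readsC` →
`exists_ringActionReading_of_reads` (then `rosatiOver_of_ringActionReading`, `kottwitzOver_of_reading`) give the CANONICAL pull-back `C.𝓜.univ.baseChange (ε ≫ pr₁)` with an
action `ρ` THAT READS (§2 `exists_slice_reading`), packaged as `witnessOf C ε ρ …` (§3), with (S-E) for EVERY witness by ★ p849317 (§4); the two readings are stated BY VALUE
over `(C, Fr, IsChartOfFrame …, ε, hε, ρ, RingActionReading C ε ρ)` as the registered-by-write sockets `stub_EHECKE : RecordEHeckeReading` ∕ `stub_ESHEET : RecordESheetReading`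
(§1) — the organ hands get the reading, the chart, the FRAME and the slice IN SCOPE.
HEAD (§6) `eLaws_of_frames` (THE ONE GEN CALLS): `∀ ctx hU7ₛ K (ιdx : Type) [Finite ιdx] Φf hΦf, ∃ Kc'' ≤ K, (∀ u ∈ K.1.1, HeckeLE u Kc'' Kc'') ∧ ∀ i, ∃ Fi₀ … τ₀, … ∧
∀ Fi ⊇ Fi₀ … [IsGalois F Fi], ∃ E : PELWitnessE … Kc'' Fi τE (Φf i), ∀ w hw, ESepAt S Kc'' w E ∧ (IsHyperspecialAt … Kc''.1.1 (w.under _) → unit form → ∀ p f, prime →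
p ∈ 𝔭_w → card → ¬ p ∣ E.N → EHeckeAt … ∧ (KottAdaptedAt → UnmixedAt → ∀ e, ETwistKerAt …))` — GEN՚s `RecordGENChoicesCofinal` E-block (cand d41c4085 :115–:119,
`Kc ↦ Kc''`, `Ef i ↦ E`) under the guards GEN holds at its chosen `(w, i)` (hyperspeciality of `Kc''` from its O-organs, the unit form and `(p, f)` from its letter,
`¬ p ∣ E.N` via `S_G ⊇` the places over the prime divisors of the finitely many `(Ef i).N`, adapted∕unmixed from KOTT ED. 2 `exists_adapted_unmixed_frame`); NO sublevel
binder, NO uniform depth (GEN A-p18 (g32) 05:15:48Z, E-pen 05:24:33Z∕05:46:17Z).  The single-frame head of cand v1∕v2 (`eLaws_of_line` over the E-line՚s anonymous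
`stub_E123` chart) is withdrawn (§5): it cannot feed frame-pinned sockets and nobody consumes it.
E-LINE ED. 5 (4cba526f), (D), E-READINGS, P-LINE, L6: ALL BYTE-IDENTICAL — nothing below imports this module.
Registered-by-write sockets {`stub_EHECKE`, `stub_ESHEET`} (`sorry`); `stub_EFRAMES : RecordEFrames` is PAID in ED. 1 (§6a `eFrames_of_line`, LA4-p02 (g2) by copy over
★ p849552 ∕ ★ p849614; name kept); `#print axioms eLaws_of_frames` = TRIO ∪ {sorryAx ← `stub_EHECKE`∕`stub_ESHEET`, L7՚s printed `stub_RELEXP` via `stub_UNIVFAM` until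
L7 ED. 2 is BUILT}; `stub_EFRAMES`, `eSepAt_of_witness` TRIO.
Budgets: default `maxHeartbeats` except the E-READINGS-sized `400000` on the two socket letters (their bodies ARE `HeckeRoofsE`∕`ETwistKerAt`); no instance, no notation.
Imports EXACTLY 7: tree `Lines.F0_P6a_PELInputs`, tree `Lines.F0_P6a_EReadings`, tree `Lines.F0_P6a_ChartFramePin` (the pin), ★ p849317, ★ p849552, ★ p849614, `HarnessLib`.
HONEST LABEL: HC_CM is proved only modulo the 7 printed citations (2 remaining named inputs: hLiu418 = stmt-HodgeConjecture-24832, h413 = stmt-HodgeConjecture-24833)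
until rung 0 closes; this workfile asserts nothing beyond its two registered `sorry` sockets.

WHY IT MIGHT FAIL (as typed).  (H-E) needs `Kc''` hyperspecial at `w` (orbit count `q+1` = number of `𝒪_F`-lines in `A[𝔭_{c•w}]`, ★ `UnitaryGroupHeckeDegreeSplitPlace`) —
guarded; (T-E)՚s (FROB-can) is the ADAPTED∕UNMIXED specialisation of the reflex type norm — guarded by `KottAdaptedAt`∕`UnmixedAt`; the sheet law needs the twist of an
inertia element to be trivial — true away from `N` (`[IsGalois ℚ F]` puts every reflex field inside `F`), and `w ∤ N` is the `¬ p ∣ E.N` guard.  Residual risk: a level-`N`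
subtlety in (t5) along the Serre cover at primes of `𝔞_γ` — excluded by row (b) `𝔞_γ ⊔ (N) = ⊤`, which the organ must PRODUCE (choice of `𝔞_γ` in its class prime to `N`).
[cite: Kottwitz1992, §5 pp. 389–391] [cite: RapoportSmithlingZhang2020Diagonal, §3.2 p. 11, §4.1 p. 17, §4.3 (4.23) p. 21] [cite: Liu2021, Lemma C.18 p. 115, Prop. D.8 p. 135]
[cite: Shimura1998, §13.1 Thm. 1 pp. 97–99; §18.6 Thm. 18.6 pp. 124–125] [cite: HarrisTaylorAMS2001, §III.4, pp. 108–110] [cite: MumfordFogartyKirwan1994, Ch. 7 §2 Def. 7.2 p. 129]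
[cite: Deligne1971TravauxShimura, Prop. 1.15 p. 132, 4.16 p. 150]
-/

set_option autoImplicit false

noncomputable section


namespace Summit.HodgeConjecture.HodgeConjecture.Cruxes.HLiu418.F0P6aEExports

set_option linter.dupNamespace false  -- `Summit.HodgeConjecture.HodgeConjecture.…` BY DESIGN (D-0017)

open CategoryTheory CategoryTheory.Limits NumberField IsDedekindDomain MulAction AlgebraicGeometry
open scoped Matrix Polynomial Pointwise
open Literature.NumberTheory.GaloisRepresentations
open Literature.NumberTheory.Automorphic Literature.NumberTheory.Automorphic.UnitaryGroup
open Literature.AlgebraicGeometry.ShimuraVarieties Literature.AlgebraicGeometry.ShimuraVarieties.UnitaryCanonicalModel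
open Literature.NumberTheory.Automorphic.Liu2021.AppendixC
open Literature.AlgebraicGeometry.Motives (AlgPoints ComplexPoints SchemeOver thickeningLift specOver)
open Literature.AlgebraicGeometry.Motives.AbelianVariety (bcSpec)
open Literature.AlgebraicGeometry.AbelianSchemes (PolarizedAbelianSchemeWithLevel AbelianSchemeOver)
open Literature.AlgebraicGeometry.ModuliOfAbelianVarieties
open Summit.HodgeConjecture.HodgeConjecture.Cruxes.HLiu418.F0P6aPELWitnessE
open Summit.HodgeConjecture.HodgeConjecture.Cruxes.HLiu418.F0P6aStubE6 (RingActionReading RosatiOver KottwitzOver ReadsC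
  readsC_of_galois_of_reading exists_reads_of_readsC exists_ringActionReading_of_reads rosatiOver_of_ringActionReading kottwitzOver_of_reading)
open Summit.HodgeConjecture.HodgeConjecture.Cruxes.HLiu418.F0P6aSigmaGAL (sigmaGAL_of_stub)
open Summit.HodgeConjecture.HodgeConjecture.Cruxes.HLiu418.F0P6aStubKOTT (KottAdaptedAt UnmixedAt)
open Summit.HodgeConjecture.HodgeConjecture.Cruxes.HLiu418.F0P6aPELInputs (ESepAt)
open Summit.HodgeConjecture.HodgeConjecture.Cruxes.HLiu418.F0P6aEReadings (EHeckeAt ETwistKerAt HeckeRoofsE CoverKerE CoverE)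
open Summit.HodgeConjecture.HodgeConjecture.Theorems.F0P6aReadsCReadingOfJunction (readsCReading_of_junction)
open Summit.HodgeConjecture.HodgeConjecture.Cruxes.HLiu418.F0P6aChartFramePin (IsChartOfFrame)

open Literature.AlgebraicGeometry.Motives (CMType)
open Literature.AlgebraicGeometry.ShimuraVarieties.UnitaryCanonicalModel.Aux (ratBasis torusFinAdelic)
open Literature.AlgebraicGeometry.ShimuraVarieties.UnitaryCurve Literature.AlgebraicGeometry.ShimuraVarieties.UnitaryCurve.AuxV
open Literature.NumberTheory.ComplexMultiplication.CMTypeOps (flip bar)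

/-! ### §0 The FRAME PIN `IsChartOfFrame hΦ C ξ k Fr` («`C` is the E3 chart of the E1 frame `Fr`», typed at `C.g`∕`C.δ`) lives in the shared module `Lines/F0_P6a_ChartFramePin.lean`
(opened below) so that the closer leaves state the SAME constant. -/

/-! ### §1 The two sockets BY VALUE over the canonical pull-back WITH ITS READING -/

set_option maxHeartbeats 400000 in
/-- **LETTER `RecordEHeckeReading` — (H-E) THE HECKE ROOFS OF THE CANONICAL PULL-BACK AT A GOOD SPLIT PLACE, FROM THE MARKING READING.**  In every letter context
(`F∕ℚ` Galois CM, `ι₁`, `J⋆` hermitian invertible, record system `S` with Hecke translates over `F`, small level `Kc`), for every slice field `Fᵢ∕F` Galois with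
`τE ∣ ι₁`, frame `Φ ∋ ι₁`, chart `C : AuxChartGS … Kc Fi τE Φ`, slice `ε` inducing `C.f` on complex points, and `𝒪_F`-action `ρ` on the canonical pull-back
`P := C.𝓜.univ ×_{𝓜.M} X` that READS through the admissible markings (L6 `RingActionReading C ε ρ`): at every place `w` with `c•w ≠ w`, `Kc` HYPERSPECIAL at `w|_{F⁺}`,
the place form a unit, and every `(p, f)` with `p` prime, `p ∈ 𝔭_w`, `N(𝔭_{c•w}) = p ^ f`, `p ∤ C.N`, the E-side Hecke roofs `HeckeRoofsE S hU7ₛ hJ hJu Kc w hw P.A ρ P.D P.pol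
P.level p f` hold — the (U4) moduli reading «both Hecke operators at `w` act on the tuple by isogeny roofs through the `𝒪_F`-stable order-`p^f` subgroups of the
`𝔭_{c•w}`-torsion».  ROAD (organ hands, L4∕L6 currency): at COMPLEX points the marked fibres at `[v, a]` and `[v, a·rc β]` are `ℂ^g` modulo the lattices read by
`C.Mρ`∕`C.Mρ_frame` in ONE rational frame (`q_spec`), the `w`-adic neighbours give the roof (★ `ComplexTorus` isogenies, algebraised by GAGA on the fibres), the orbit
count `q+1` is ★ `UnitaryGroupHeckeDegreeSplitPlace`∕`GL2HeckePrimitiveDoubleCosetDegree`; then `ℂ`-points ↦ `F̄_w`-points along ★ `exists_ringHom_comp_eq` (p847344 pattern)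
with ★ `IsogenyRoofTransportAlongIso`.  NOT asserted. (print: Liu2021, Lemma C.18 p. 115, Prop. D.8 p. 135) (print: HarrisTaylorAMS2001, §III.4, pp. 108–110)
(print: Kottwitz1992, §5 pp. 389–391) (print: RapoportSmithlingZhang2020Diagonal, §4.1 p. 17, §4.3 (4.23) p. 21) -/
def RecordEHeckeReading : Prop :=
  ∀ (F : Type) [Field F] [NumberField F] [IsCMField F] [IsGalois ℚ F] (ι₁ : F →+* ℂ)
    (Jstar : Matrix (Fin 2) (Fin 2) F) (hJ : (Jstar.map (IsCMField.complexConj F))ᵀ = Jstar) (hJu : IsUnit Jstar)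
    (K₀ : C5.OpenCompactSubgroup (GSAdele F Jstar)) (S : RecordSystemGS F Jstar ι₁ K₀) (hU7ₛ : S.HeckeTranslateDefinedOver) (Kc : C5.SmallLevel K₀)
    (Fi : Type) [Field Fi] [NumberField Fi] [Algebra F Fi] [IsGalois F Fi] (τE : Fi →+* ℂ) (_hτE : τE.comp (algebraMap F Fi) = ι₁)
    (Φ : Set (F →+* ℂ)) (hΦ : IsCMTypeThrough ι₁ Φ) (C : AuxChartGS F ι₁ Jstar K₀ S Kc Fi τE Φ)
    (ξ : F) (k : ℕ) (Fr : SymplecticFrameV F (RingHom.id F) Jstar ((k : ℚ) • ξ) C.g C.δ) (_hpin : IsChartOfFrame hΦ C ξ k Fr)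
    (ε : (Literature.AlgebraicGeometry.Motives.baseChange F Fi).obj (S.M.obj Kc) ⟶
        (Literature.AlgebraicGeometry.Motives.baseChange ℚ Fi).obj C.𝓜.M)
    (_hε : letI : Algebra Fi ℂ := τE.toAlgebra
      ∀ (P : ComplexPoints ((Literature.AlgebraicGeometry.Motives.baseChange F Fi).obj (S.M.obj Kc)))
        (Pflat : letI : Algebra F ℂ := ι₁.toAlgebra; ComplexPoints (S.M.obj Kc)),
        Pflat.left = P.left ≫ pullback.fst (S.M.obj Kc).hom (bcSpec F Fi) →
        (AlgPoints.map ε P).left ≫ pullback.fst C.𝓜.M.hom (bcSpec ℚ Fi) =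
          (letI : Algebra F ℂ := ι₁.toAlgebra; (C.f (S.pts Kc Pflat)).left))
    (ρ : AbelianSchemeOver.RingAction (𝓞 F) (C.𝓜.univ.baseChange (ε.left ≫ pullback.fst C.𝓜.M.hom (bcSpec ℚ Fi))).A),
    RingActionReading C ε ρ →
    ∀ (w : HeightOneSpectrum (𝓞 F)) (hw : (IsCMField.complexConj F) • w ≠ w),
      UnitaryGroup.IsHyperspecialAt ↥(maximalRealSubfield F) F (IsCMField.complexConj F) 2 Jstar Kc.1.1
          (w.under (𝓞 ↥(maximalRealSubfield F))) →
      (UnitaryGroup.isUnit_placeForm Jstar hJu w).unit ∈ glInt 2 (w.adicCompletion F) →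
      ∀ (pChar fDeg : ℕ), Nat.Prime pChar → (pChar : 𝓞 F) ∈ w.asIdeal →
        Nat.card (𝓞 F ⧸ ((IsCMField.complexConj F) • w).asIdeal) = pChar ^ fDeg → ¬ pChar ∣ C.N →
        letI P := C.𝓜.univ.baseChange (ε.left ≫ pullback.fst C.𝓜.M.hom (bcSpec ℚ Fi))
        HeckeRoofsE S hU7ₛ hJ hJu Kc w hw P.A ρ P.D P.pol P.level pChar fDeg

/-- **SOCKET `stub_EHECKE`** (registered by write): the letter `RecordEHeckeReading` — (H-E) for the canonical pull-back with reading.  NOT proved here; organ hands by name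
(LA4-plan (g0) DEAL #20 «(H-E)-CENTRAL» = the `t₂`-conjunct, LA4-p01 (g2); the `t₁`-lines conjuncts to be dealt). [cite: Liu2021, Lemma C.18 p. 115]
[cite: Kottwitz1992, §5 pp. 389–391] -/
theorem stub_EHECKE : RecordEHeckeReading :=
  Summit.HodgeConjecture.HodgeConjecture.Cruxes.HLiu418.F0P6aStubEHECKE.stub_EHECKE_of_line

set_option maxHeartbeats 400000 in
/-- **LETTER `RecordESheetReading` — (T-E) THE TWIST IDEALS AND THE SERRE COVERS BETWEEN THE SHEETS OF THE CANONICAL PULL-BACK, FROM THE MARKING READING.**  Same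
binder prefix as `RecordEHeckeReading`, plus the KOTT guards `KottAdaptedAt ι₁ w Φ`, `UnmixedAt ι₁ w Φ` (the (FROB-can) pin below is the ADAPTED∕UNMIXED specialisation
of the reflex type norm) and a datum sheet `e`; conclusion = the body of E-READINGS `ETwistKerAt S Kc w e E pChar fDeg` TOKEN FOR TOKEN at the canonical tuple
(`E.N ↦ C.N`, `E.P.* ↦ P.*`, `E.ρ ↦ ρ`): twist data `(𝔞_γ, n_γ)_{γ ∈ Gal(Fᵢ∕F)}` with rows (a) `(n_γ) = 𝔞_γ 𝔞̄_γ`, (b) `𝔞_γ ⊥ N`, (c) `𝔞_γ ≠ 0`, (FROB-𝔞), (FROB-n), (π1),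
(FROB-can) `𝔞_{γ_σ} = 𝔞_can(mOf ι₁ Φ (σ₀ ∘ ·), τR, w)`, (K-law) `CoverKerE … e′ … (e′ ∘ γ) 𝔞_γ n_γ y` and (cover) `CoverE …` — THE SHEET LAW «`(𝟙 ⊗ γ)^* P ≅ P ⊗_{𝒪_F} 𝔞_γ⁻¹`
as polarised `𝒪_F`-families with level over `X`» + Shimura–Taniyama at `w`.  ROAD (organ hands): `ε(y, τE ∘ γ) = γ̃ • ε(γ̃⁻¹ • y, τE)` (functoriality of points) + CM
reciprocity on BOTH sides at the special points (`S.recip`∕`C.cm_recip` unitary vs ★ `cmRecipMatrix` Siegel; their quotient is the reflex type norm `N_Φ`, ★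
`F0P6aCanonicalTwistIdealAsTypeNorm` organs #4∕#5) ⇒ the Serre cover at CM points; CM density on each component + ★ rigidity (`eq_of_forall_exists_fieldPoint`, B-α)
for the family statement; the arithmetic rows of `𝔞_can` are ★ p849355 `canonicalTwistIdeal_eLetterRows_sigma`; `ℂ` ↦ `F̄_w` as for (H-E).  NOT asserted.
(print: Shimura1998, §13.1 Thm. 1 pp. 97–99; §18.6 Thm. 18.6 pp. 124–125) (print: RapoportSmithlingZhang2020Diagonal, §3.2 p. 11, §4.3 p. 20) (print: Conrad2004GrossZagier, §7, Thm. 7.6) -/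
def RecordESheetReading : Prop :=
  ∀ (F : Type) [Field F] [NumberField F] [IsCMField F] [IsGalois ℚ F] (ι₁ : F →+* ℂ)
    (Jstar : Matrix (Fin 2) (Fin 2) F) (hJ : (Jstar.map (IsCMField.complexConj F))ᵀ = Jstar) (hJu : IsUnit Jstar)
    (K₀ : C5.OpenCompactSubgroup (GSAdele F Jstar)) (S : RecordSystemGS F Jstar ι₁ K₀) (_hU7ₛ : S.HeckeTranslateDefinedOver) (Kc : C5.SmallLevel K₀)
    (Fi : Type) [Field Fi] [NumberField Fi] [Algebra F Fi] [IsGalois F Fi] (τE : Fi →+* ℂ) (_hτE : τE.comp (algebraMap F Fi) = ι₁)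
    (Φ : Set (F →+* ℂ)) (hΦ : IsCMTypeThrough ι₁ Φ) (C : AuxChartGS F ι₁ Jstar K₀ S Kc Fi τE Φ)
    (ξ : F) (k : ℕ) (Fr : SymplecticFrameV F (RingHom.id F) Jstar ((k : ℚ) • ξ) C.g C.δ) (_hpin : IsChartOfFrame hΦ C ξ k Fr)
    (ε : (Literature.AlgebraicGeometry.Motives.baseChange F Fi).obj (S.M.obj Kc) ⟶
        (Literature.AlgebraicGeometry.Motives.baseChange ℚ Fi).obj C.𝓜.M)
    (_hε : letI : Algebra Fi ℂ := τE.toAlgebra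
      ∀ (P : ComplexPoints ((Literature.AlgebraicGeometry.Motives.baseChange F Fi).obj (S.M.obj Kc)))
        (Pflat : letI : Algebra F ℂ := ι₁.toAlgebra; ComplexPoints (S.M.obj Kc)),
        Pflat.left = P.left ≫ pullback.fst (S.M.obj Kc).hom (bcSpec F Fi) →
        (AlgPoints.map ε P).left ≫ pullback.fst C.𝓜.M.hom (bcSpec ℚ Fi) =
          (letI : Algebra F ℂ := ι₁.toAlgebra; (C.f (S.pts Kc Pflat)).left))
    (ρ : AbelianSchemeOver.RingAction (𝓞 F) (C.𝓜.univ.baseChange (ε.left ≫ pullback.fst C.𝓜.M.hom (bcSpec ℚ Fi))).A),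
    RingActionReading C ε ρ →
    ∀ (w : HeightOneSpectrum (𝓞 F)) (_hw : (IsCMField.complexConj F) • w ≠ w),
      UnitaryGroup.IsHyperspecialAt ↥(maximalRealSubfield F) F (IsCMField.complexConj F) 2 Jstar Kc.1.1
          (w.under (𝓞 ↥(maximalRealSubfield F))) →
      (UnitaryGroup.isUnit_placeForm Jstar hJu w).unit ∈ glInt 2 (w.adicCompletion F) →
      ∀ (pChar fDeg : ℕ), Nat.Prime pChar → (pChar : 𝓞 F) ∈ w.asIdeal →
        Nat.card (𝓞 F ⧸ ((IsCMField.complexConj F) • w).asIdeal) = pChar ^ fDeg → ¬ pChar ∣ C.N →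
        KottAdaptedAt ι₁ w Φ → UnmixedAt ι₁ w Φ →
        ∀ (e : Fi →ₐ[F] AlgebraicClosure (w.adicCompletion F)),
        letI P := C.𝓜.univ.baseChange (ε.left ≫ pullback.fst C.𝓜.M.hom (bcSpec ℚ Fi))
  ∃ (twistIdeal : (Fi ≃ₐ[F] Fi) → Ideal (𝓞 F)) (twistNorm : (Fi ≃ₐ[F] Fi) → ℕ),
    (∀ γ : Fi ≃ₐ[F] Fi, Ideal.span {((twistNorm γ : ℕ) : 𝓞 F)} = twistIdeal γ * (IsCMField.complexConj F) • twistIdeal γ) ∧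
    (∀ γ : Fi ≃ₐ[F] Fi, twistIdeal γ ⊔ Ideal.span {((C.N : ℕ) : 𝓞 F)} = ⊤) ∧
    (∀ γ : Fi ≃ₐ[F] Fi, twistIdeal γ ≠ ⊥) ∧
    (∀ (σ : Field.absoluteGaloisGroup (w.adicCompletion F)), IsAbsArithFrob σ → ∀ γ : Fi ≃ₐ[F] Fi,
      ((AlgEquiv.restrictScalars F (Field.absoluteGaloisGroup.toAlgEquiv (w.adicCompletion F) σ) :
          AlgebraicClosure (w.adicCompletion F) ≃ₐ[F] AlgebraicClosure (w.adicCompletion F)) :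
          AlgebraicClosure (w.adicCompletion F) →ₐ[F] AlgebraicClosure (w.adicCompletion F)).comp e = e.comp (γ : Fi →ₐ[F] Fi) →
      w.asIdeal ∣ twistIdeal γ) ∧
    (∀ (σ : Field.absoluteGaloisGroup (w.adicCompletion F)), IsAbsArithFrob σ → ∀ γ : Fi ≃ₐ[F] Fi,
      ((AlgEquiv.restrictScalars F (Field.absoluteGaloisGroup.toAlgEquiv (w.adicCompletion F) σ) :
          AlgebraicClosure (w.adicCompletion F) ≃ₐ[F] AlgebraicClosure (w.adicCompletion F)) :
          AlgebraicClosure (w.adicCompletion F) →ₐ[F] AlgebraicClosure (w.adicCompletion F)).comp e = e.comp (γ : Fi →ₐ[F] Fi) →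
      twistNorm γ = pChar ^ fDeg) ∧
    (∀ (σ : Field.absoluteGaloisGroup (w.adicCompletion F)), IsAbsArithFrob σ → ∀ γ : Fi ≃ₐ[F] Fi,
      ((AlgEquiv.restrictScalars F (Field.absoluteGaloisGroup.toAlgEquiv (w.adicCompletion F) σ) :
          AlgebraicClosure (w.adicCompletion F) ≃ₐ[F] AlgebraicClosure (w.adicCompletion F)) :
          AlgebraicClosure (w.adicCompletion F) →ₐ[F] AlgebraicClosure (w.adicCompletion F)).comp e = e.comp (γ : Fi →ₐ[F] Fi) →
      twistIdeal γ ⊔ (((IsCMField.complexConj F) • w).asIdeal : Ideal (𝓞 F)) = ⊤) ∧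
    (∀ (σ₀ : AlgebraicClosure (w.adicCompletion F) →+* ℂ), σ₀.comp (algebraMap F (AlgebraicClosure (w.adicCompletion F))) = ι₁ →
      ∀ (τR : (F →+* AlgebraicClosure (w.adicCompletion F)) → (𝓞 F →+* ↥(closureValuationSubring (w.adicCompletion F)))),
        (∀ (τ : F →+* AlgebraicClosure (w.adicCompletion F)) (x : 𝓞 F),
          ((τR τ x : ↥(closureValuationSubring (w.adicCompletion F))) : AlgebraicClosure (w.adicCompletion F)) = τ (x : F)) →
      ∀ (σ : Field.absoluteGaloisGroup (w.adicCompletion F)), IsAbsArithFrob σ → ∀ γ : Fi ≃ₐ[F] Fi,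
        ((AlgEquiv.restrictScalars F (Field.absoluteGaloisGroup.toAlgEquiv (w.adicCompletion F) σ) :
            AlgebraicClosure (w.adicCompletion F) ≃ₐ[F] AlgebraicClosure (w.adicCompletion F)) :
            AlgebraicClosure (w.adicCompletion F) →ₐ[F] AlgebraicClosure (w.adicCompletion F)).comp e = e.comp (γ : Fi →ₐ[F] Fi) →
        twistIdeal γ = ∏ τ ∈ Finset.univ.filter (fun τ : F →+* AlgebraicClosure (w.adicCompletion F) =>
            mOf ι₁ Φ (σ₀.comp τ) ≠ 0 ∧ RingHom.ker ((IsLocalRing.residue ↥(closureValuationSubring (w.adicCompletion F))).comp (τR τ)) ≠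
              (((IsCMField.complexConj F) • w).asIdeal : Ideal (𝓞 F))),
          RingHom.ker ((IsLocalRing.residue ↥(closureValuationSubring (w.adicCompletion F))).comp (τR τ))) ∧
    (∀ (e' : Fi →ₐ[F] AlgebraicClosure (w.adicCompletion F)) (γ : Fi ≃ₐ[F] Fi)
      (y : AlgPoints (S.M.obj Kc) (AlgebraicClosure (w.adicCompletion F))),
      CoverKerE S Kc w e' P.A ρ P.D P.pol P.level (e'.comp (γ : Fi →ₐ[F] Fi)) (twistIdeal γ) (twistNorm γ) y) ∧
    ∀ (e' : Fi →ₐ[F] AlgebraicClosure (w.adicCompletion F)) (γ : Fi ≃ₐ[F] Fi)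
      (y : AlgPoints (S.M.obj Kc) (AlgebraicClosure (w.adicCompletion F))),
      CoverE S Kc w e' P.A ρ P.D P.pol P.level (e'.comp (γ : Fi →ₐ[F] Fi)) (twistIdeal γ) (twistNorm γ) y

/-- **SOCKET `stub_ESHEET`** (registered by write): the letter `RecordESheetReading` — (T-E) for the canonical pull-back with reading.  NOT proved here; organ hands by name
(sheet law: L6∕Σ-GAL currency (A-p04 (g24), A-p06 (g34)); arithmetic rows: ★ LA4-p04 (g2) p849355). [cite: Shimura1998, §13.1 Thm. 1; §18.6]
[cite: RapoportSmithlingZhang2020Diagonal, §3.2 p. 11, §4.3 p. 20] -/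
theorem stub_ESHEET : RecordESheetReading :=
  Summit.HodgeConjecture.HodgeConjecture.Cruxes.HLiu418.F0P6aStubESHEET.stub_ESHEET_of_line

/-! ### §2 The witness with its reading, REBUILT from the E-line՚s public stubs and the L6 reading chain (sorry-free) -/

/-- **THE SLICE, THE `𝒪_F`-ACTION AND ITS READING** (sorry-free given the E-line ED. 5 and the L6∕Σ-GAL leaves): for a chart `C` over a Galois slice field with
`τE ∣ ι₁` and a frame `Φ ∋ ι₁` there are a slice morphism `ε : X ⟶ 𝓜.M ⊗ Fᵢ` inducing `C.f` on complex points (`stub_E4` ★ E4 then `stub_E5` ★ E5), injective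
on complex points (★ `algPoints_map_injective_of_sliceDescent` over `C.f_injective`), and an `𝒪_F`-action `ρ` on the CANONICAL pull-back `C.𝓜.univ ×_{𝓜.M} X` that
READS through the admissible markings (Σ-AN ★ `readsCReading_of_junction` → Σ-GAL `sigmaGAL_of_stub` → `readsC_of_galois_of_reading` → `exists_reads_of_readsC` →
`exists_ringActionReading_of_reads`).  This is the E-line head՚s E4–E6 composition with the reading KEPT instead of discarded.
[cite: Kottwitz1992, §5 pp. 389–391] [cite: Milne2005ShimuraVarieties, Prop. 13.1 p. 117] [cite: Lange2023AbelianVarietiesComplex, §3.4 Prop. 3.4.1] -/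
theorem exists_slice_reading (F : Type) [Field F] [NumberField F] [IsCMField F] [IsGalois ℚ F] (ι₁ : F →+* ℂ)
    (Jstar : Matrix (Fin 2) (Fin 2) F) (hJ : (Jstar.map (IsCMField.complexConj F))ᵀ = Jstar) (hJu : IsUnit Jstar)
    (K₀ : C5.OpenCompactSubgroup (GSAdele F Jstar)) (S : RecordSystemGS F Jstar ι₁ K₀) (Kc : C5.SmallLevel K₀)
    (Fi : Type) [Field Fi] [NumberField Fi] [Algebra F Fi] [IsGalois F Fi] (τE : Fi →+* ℂ) (hτE : τE.comp (algebraMap F Fi) = ι₁)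
    (Φ : Set (F →+* ℂ)) (hΦ : IsCMTypeThrough ι₁ Φ) (C : AuxChartGS F ι₁ Jstar K₀ S Kc Fi τE Φ) :
    ∃ (ε : (Literature.AlgebraicGeometry.Motives.baseChange F Fi).obj (S.M.obj Kc) ⟶
        (Literature.AlgebraicGeometry.Motives.baseChange ℚ Fi).obj C.𝓜.M)
      (_ : letI : Algebra Fi ℂ := τE.toAlgebra
        ∀ (P : ComplexPoints ((Literature.AlgebraicGeometry.Motives.baseChange F Fi).obj (S.M.obj Kc)))
          (Pflat : letI : Algebra F ℂ := ι₁.toAlgebra; ComplexPoints (S.M.obj Kc)),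
          Pflat.left = P.left ≫ pullback.fst (S.M.obj Kc).hom (bcSpec F Fi) →
          (AlgPoints.map ε P).left ≫ pullback.fst C.𝓜.M.hom (bcSpec ℚ Fi) =
            (letI : Algebra F ℂ := ι₁.toAlgebra; (C.f (S.pts Kc Pflat)).left))
      (ρ : AbelianSchemeOver.RingAction (𝓞 F) (C.𝓜.univ.baseChange (ε.left ≫ pullback.fst C.𝓜.M.hom (bcSpec ℚ Fi))).A),
      RingActionReading C ε ρ ∧
      (letI : Algebra Fi ℂ := τE.toAlgebra
       Function.Injective
        (AlgPoints.map ε : ComplexPoints ((Literature.AlgebraicGeometry.Motives.baseChange F Fi).obj (S.M.obj Kc)) →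
          ComplexPoints ((Literature.AlgebraicGeometry.Motives.baseChange ℚ Fi).obj C.𝓜.M))) := by
  -- E4: the complex morphism inducing the point map; E5: descent to the slice field
  have hψ := stub_E4 F ι₁ Jstar hJ hJu K₀ S Kc Fi τE hτE Φ C
  obtain ⟨ε, hε⟩ := stub_E5 F ι₁ Jstar hJ hJu K₀ S Kc Fi τE hτE Φ C hψ
  -- `sep`: `ε` is injective on complex points because the chart՚s point map is (★ p847435 over `C.f_injective`)
  have hsep := RecordSystemGS.algPoints_map_injective_of_sliceDescent S Kc C.𝓜.M C.f τE hτE ε hε C.f_injective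
  -- Σ-AN (★ p848496) at the junction field, Σ-GAL (leaf), then the reading chain of the L6 leaf
  haveI := C.smooth_M
  obtain ⟨Y, hY, hRC⟩ :=
    readsCReading_of_junction (iFi := τE.toAlgebra) S Kc hτE
      C.hg C.hδ C.hN C.𝓜 C.quasiProjective_M C.Sc C.ιc C.isColimit_ιc.some C.unif C.unif_cont C.unif_open C.unif_surj C.unif_iff C.unif_hol
      C.f C.piece C.Z C.u C.rep C.rep_spec C.Z_hol C.Z_mem C.f_mk C.Mρ (fun a v hv b => (C.Mρ_kottwitz a v hv b).imp fun _ h => h.1)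
      C.Z_equivariant C.junction ε hε Literature.AlgebraicGeometry.ModuliOfAbelianVarieties.siegelUniversalFamilyUniformisation_holds
  have hG := sigmaGAL_of_stub F ι₁ Jstar hJ hJu K₀ S Kc Fi τE hτE Φ hΦ C ε hε Literature.AlgebraicGeometry.ModuliOfAbelianVarieties.siegelUniversalFamilyUniformisation_holds Y hY hRC
  obtain ⟨i, hi, hR⟩ := exists_reads_of_readsC hτE C ε Y hY (readsC_of_galois_of_reading C ε Y hY hG hRC)
  obtain ⟨ρ, hρ⟩ := exists_ringActionReading_of_reads hτE C ε i hi hR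
  exact ⟨ε, hε, ρ, hρ, hsep⟩

/-! ### §3 Packaging: the ED.-5 witness ON the canonical pull-back -/

/-- **`witnessOf C ε ρ hRos hKot hsep`** — the `PELWitnessE` whose tuple IS the canonical pull-back `C.𝓜.univ ×_{𝓜.M} X` along `ε` (★ `baseChange_isBaseChangeVia`
supplies `G Ĝ isBaseChange`), with the action `ρ`, Rosati `hRos`, Kottwitz `hKot` and `sep`; `g N δ 𝓜` read off the chart.  The E-line head builds the same object
anonymously inside `Nonempty`; here it is a named term so that laws about `(C, ε, ρ)` are laws about the witness BY `rfl`.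
[cite: RapoportSmithlingZhang2020Diagonal, §4.1 p. 17] [cite: Kottwitz1992, §5 pp. 389–391] -/
def witnessOf {F : Type} [Field F] [NumberField F] [IsCMField F] {ι₁ : F →+* ℂ}
    {Jstar : Matrix (Fin 2) (Fin 2) F} {K₀ : C5.OpenCompactSubgroup (GSAdele F Jstar)} {S : RecordSystemGS F Jstar ι₁ K₀} {Kc : C5.SmallLevel K₀}
    {Fi : Type} [Field Fi] [NumberField Fi] [Algebra F Fi] {τE : Fi →+* ℂ} {Φ : Set (F →+* ℂ)} (C : AuxChartGS F ι₁ Jstar K₀ S Kc Fi τE Φ)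
    (ε : (Literature.AlgebraicGeometry.Motives.baseChange F Fi).obj (S.M.obj Kc) ⟶
        (Literature.AlgebraicGeometry.Motives.baseChange ℚ Fi).obj C.𝓜.M)
    (ρ : AbelianSchemeOver.RingAction (𝓞 F) (C.𝓜.univ.baseChange (ε.left ≫ pullback.fst C.𝓜.M.hom (bcSpec ℚ Fi))).A)
    (hRos : RosatiOver C ε ρ) (hKot : KottwitzOver C ε ρ)
    (hsep : letI : Algebra Fi ℂ := τE.toAlgebra
       Function.Injective
        (AlgPoints.map ε : ComplexPoints ((Literature.AlgebraicGeometry.Motives.baseChange F Fi).obj (S.M.obj Kc)) →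
          ComplexPoints ((Literature.AlgebraicGeometry.Motives.baseChange ℚ Fi).obj C.𝓜.M))) :
    PELWitnessE F ι₁ Jstar K₀ S Kc Fi τE Φ where
  g := C.g
  N := C.N
  δ := C.δ
  hδN := ⟨C.hδ, C.hN⟩
  P := C.𝓜.univ.baseChange (ε.left ≫ pullback.fst C.𝓜.M.hom (bcSpec ℚ Fi))
  hg := C.g_eq
  𝓜 := C.𝓜
  ε := ε
  G := pullback.fst C.𝓜.univ.A.X.hom (ε.left ≫ pullback.fst C.𝓜.M.hom (bcSpec ℚ Fi))
  Ĝ := pullback.fst C.𝓜.univ.D.hat.X.hom (ε.left ≫ pullback.fst C.𝓜.M.hom (bcSpec ℚ Fi))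
  isBaseChange := C.𝓜.univ.baseChange_isBaseChangeVia (ε.left ≫ pullback.fst C.𝓜.M.hom (bcSpec ℚ Fi))
  sep := hsep
  ρ := ρ
  rosati := hRos
  kottwitz := hKot

/-! ### §4 The three laws of `witnessOf` -/

/-- **(S-E) FOR EVERY ED.-5 WITNESS, BY VALUE** — ★ p849317 `SiegelFineModuliScheme.eq_of_tupleRel_id_thickeningLift` at `(E.𝓜, E.ε, E.P, S.projective Kc,
E.isBaseChange, τE, E.sep)`; the `𝒪_F`-clause of `tupleIsoAt` is not even used (LA4-p01 (g2) consumer cert `eSepAt_of_witness`, TRIO — credited).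
[cite: MumfordFogartyKirwan1994, Ch. 7 §2 Def. 7.2 p. 129; §3 Thm. 7.9 p. 139] [cite: Deligne1971TravauxShimura, 4.16 p. 150] -/
theorem eSepAt_of_witness {F : Type} [Field F] [NumberField F] [IsCMField F] {ι₁ : F →+* ℂ}
    {Jstar : Matrix (Fin 2) (Fin 2) F} {K₀ : C5.OpenCompactSubgroup (GSAdele F Jstar)} {S : RecordSystemGS F Jstar ι₁ K₀} {Kc : C5.SmallLevel K₀}
    {Fi : Type} [Field Fi] [NumberField Fi] [Algebra F Fi] {τE : Fi →+* ℂ} {Φ : Set (F →+* ℂ)} (E : PELWitnessE F ι₁ Jstar K₀ S Kc Fi τE Φ)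
    (w : HeightOneSpectrum (𝓞 F)) : ESepAt S Kc w E := by
  intro e' y₁ y₂ h
  obtain ⟨G, Ĝ, h1, h2, h3, h4, -⟩ := h
  exact E.𝓜.eq_of_tupleRel_id_thickeningLift E.ε E.P (S.projective Kc) E.isBaseChange τE E.sep e' y₁ y₂ ⟨h1, h2, h3, h4⟩

/-- **(H-E) FOR `witnessOf`, FROM THE SOCKET** — `EHeckeAt … (witnessOf C ε ρ …) p f` IS `HeckeRoofsE` of the canonical tuple (the projections of `witnessOf` reduce by
`rfl`), so `stub_EHECKE` applies on the nose. [cite: Liu2021, Lemma C.18 p. 115] [cite: Kottwitz1992, §5 pp. 389–391] -/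
theorem eHeckeAt_witnessOf (F : Type) [Field F] [NumberField F] [IsCMField F] [IsGalois ℚ F] (ι₁ : F →+* ℂ)
    (Jstar : Matrix (Fin 2) (Fin 2) F) (hJ : (Jstar.map (IsCMField.complexConj F))ᵀ = Jstar) (hJu : IsUnit Jstar)
    (K₀ : C5.OpenCompactSubgroup (GSAdele F Jstar)) (S : RecordSystemGS F Jstar ι₁ K₀) (hU7ₛ : S.HeckeTranslateDefinedOver) (Kc : C5.SmallLevel K₀)
    (Fi : Type) [Field Fi] [NumberField Fi] [Algebra F Fi] [IsGalois F Fi] (τE : Fi →+* ℂ) (hτE : τE.comp (algebraMap F Fi) = ι₁)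
    (Φ : Set (F →+* ℂ)) (hΦ : IsCMTypeThrough ι₁ Φ) (C : AuxChartGS F ι₁ Jstar K₀ S Kc Fi τE Φ)
    (ξ : F) (k : ℕ) (Fr : SymplecticFrameV F (RingHom.id F) Jstar ((k : ℚ) • ξ) C.g C.δ) (hpin : IsChartOfFrame hΦ C ξ k Fr)
    (ε : (Literature.AlgebraicGeometry.Motives.baseChange F Fi).obj (S.M.obj Kc) ⟶
        (Literature.AlgebraicGeometry.Motives.baseChange ℚ Fi).obj C.𝓜.M)
    (hε : letI : Algebra Fi ℂ := τE.toAlgebra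
      ∀ (P : ComplexPoints ((Literature.AlgebraicGeometry.Motives.baseChange F Fi).obj (S.M.obj Kc)))
        (Pflat : letI : Algebra F ℂ := ι₁.toAlgebra; ComplexPoints (S.M.obj Kc)),
        Pflat.left = P.left ≫ pullback.fst (S.M.obj Kc).hom (bcSpec F Fi) →
        (AlgPoints.map ε P).left ≫ pullback.fst C.𝓜.M.hom (bcSpec ℚ Fi) =
          (letI : Algebra F ℂ := ι₁.toAlgebra; (C.f (S.pts Kc Pflat)).left))
    (ρ : AbelianSchemeOver.RingAction (𝓞 F) (C.𝓜.univ.baseChange (ε.left ≫ pullback.fst C.𝓜.M.hom (bcSpec ℚ Fi))).A)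
    (hρ : RingActionReading C ε ρ) (hRos : RosatiOver C ε ρ) (hKot : KottwitzOver C ε ρ)
    (hsep : letI : Algebra Fi ℂ := τE.toAlgebra
       Function.Injective
        (AlgPoints.map ε : ComplexPoints ((Literature.AlgebraicGeometry.Motives.baseChange F Fi).obj (S.M.obj Kc)) →
          ComplexPoints ((Literature.AlgebraicGeometry.Motives.baseChange ℚ Fi).obj C.𝓜.M)))
    (w : HeightOneSpectrum (𝓞 F)) (hw : (IsCMField.complexConj F) • w ≠ w)
    (hhyp : UnitaryGroup.IsHyperspecialAt ↥(maximalRealSubfield F) F (IsCMField.complexConj F) 2 Jstar Kc.1.1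
      (w.under (𝓞 ↥(maximalRealSubfield F))))
    (hunit : (UnitaryGroup.isUnit_placeForm Jstar hJu w).unit ∈ glInt 2 (w.adicCompletion F))
    (pChar fDeg : ℕ) (hp : Nat.Prime pChar) (hpw : (pChar : 𝓞 F) ∈ w.asIdeal)
    (hcard : Nat.card (𝓞 F ⧸ ((IsCMField.complexConj F) • w).asIdeal) = pChar ^ fDeg) (hN : ¬ pChar ∣ C.N) :
    EHeckeAt S hU7ₛ hJ hJu Kc w hw (witnessOf C ε ρ hRos hKot hsep) pChar fDeg :=
  stub_EHECKE F ι₁ Jstar hJ hJu K₀ S hU7ₛ Kc Fi τE hτE Φ hΦ C ξ k Fr hpin ε hε ρ hρ w hw hhyp hunit pChar fDeg hp hpw hcard hN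

end Summit.HodgeConjecture.HodgeConjecture.Cruxes.HLiu418.F0P6aEExports
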